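import Literature.Algebra.Module.FlatTensorOfFlatLocalization
import Literature.AlgebraicGeometry.Modules.PullbackStalk
import Literature.AlgebraicGeometry.Modules.PullbackSectionsBaseChange
import HarnessLib

/-!
# Tor-independence of the projections of a product over a field: the stalk `(p^*G)_z` is flat over `𝒪_{Y, q z}`

Layer `Literature/AlgebraicGeometry/Modules`. For a CARTESIAN square of schemes over a field
```
Z ——q——→ Y
|p        |iY
X ——iX——→ Spec k
```
(`IsPullback p q iX iY`), an ARBITRARY `𝒪_X`-module `G` and a point `z ∈ Z`, the stalk `(p^*G)_z` — an `𝒪_{Z,z}`-module, hence an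
`𝒪_{Y,q z}`-module through `q_z♯ : 𝒪_{Y,q z} → 𝒪_{Z,z}` — is FLAT over `𝒪_{Y,q z}` (**`flat_stalk_pullback_of_isPullback`**). This is the
local algebra behind «`Tor_i^{𝒪_Z}(p^*G, q^*H) = 0` for `i > 0`» (the projections of a product over a field are Tor-independent;
EGA III 6.7, The Stacks Project Tag 08II in the affine case), in the form consumed by the exactness of `N ↦ p^*G ⊗ q^*N`
(`Modules/BoxTensorExact`). Proof (0 named facts): on affine charts `U ∋ p z`, `V ∋ q z`, `W = p⁻¹U ∩ q⁻¹V ∋ z` the section rings form a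
pushout square over `Γ(Spec k, ⊤) ≅ k` (`Modules/PullbackSectionsBaseChange.isPushout_sections_of_isPullback`); the stalks are
localizations of the section rings (Mathlib `IsAffineOpen.isLocalization_stalk`), so `𝒪_{Z,z}` is flat over `Γ(W)`; the stalk is
`(p^*G)_z ≅ 𝒪_{Z,z} ⊗_{𝒪_{X,p z}} G_{p z}` (`Modules/PullbackStalk.stalkPullbackIso`); and the pure algebra is
`Literature/Algebra/Module/FlatTensorOfFlatLocalization` (`L ⊗_{Oₓ} V` is flat over `O_y`). No instances are declared (all algebra
structures on section rings and stalks are local `letI`s inside the proof; the `𝒪_{Y,q z}`-module structure on the stalk in the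
STATEMENT is `Module.compHom` along `q_z♯`, spelled as in `ModuleCat.extendScalars`).

## References

* A. Grothendieck, *EGA III* (Publ. IHÉS 17, 1963), §6.7 (Tor-independence, Künneth). [EGAIII2]
* The Stacks Project, Tag 08II (Tor independence and base change, affine case), Tag 00HI. [StacksProject]
* H. Matsumura, *Commutative Ring Theory* (1987), §7 (p. 46), Thm. 4.4–4.5. [Matsumura1987]
* U. Görtz, T. Wedhorn, *Algebraic Geometry I* (2nd ed. 2020), (7.8.6) (stalks of `f^*`), Prop. 4.16 (affine fibre products). [GortzWedhorn2020]
-/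

noncomputable section

-- `TopCat.Presheaf`/`Scheme.Modules` are not reducible (as in Mathlib's `AlgebraicGeometry/Modules`).
set_option backward.isDefEq.respectTransparency false

open CategoryTheory CategoryTheory.Limits AlgebraicGeometry TopologicalSpace Opposite
open scoped TensorProduct

universe u

namespace Literature.AlgebraicGeometry.Modules

open Literature.Algebra.Module

variable {k : Type u} [Field k] {X Y Z : Scheme.{u}} {iX : X ⟶ Spec (.of k)} {iY : Y ⟶ Spec (.of k)} {p : Z ⟶ X} {q : Z ⟶ Y}

/-- `Γ(Spec k, ⊤)` is a field (it is `k`, `Scheme.ΓSpecIso`). [cite: GortzWedhorn2020, (2.10) (global sections of `Spec A`)] -/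
theorem isField_sections_spec_top (k : Type u) [Field k] : IsField (Γ(Spec (CommRingCat.of k), (⊤ : (Spec (CommRingCat.of k)).Opens))) :=
  MulEquiv.isField (Field.toIsField k) (Scheme.ΓSpecIso (CommRingCat.of k)).commRingCatIsoToRingEquiv.toMulEquiv

/-- **Tor-independence over a field, stalkwise: `(p^*G)_z` is flat over `𝒪_{Y,q z}`.** For a cartesian square `Z = X ×_k Y` over a
field (`IsPullback p q iX iY`), any `𝒪_X`-module `G` and `z ∈ Z`, the stalk `(p^*G)_z` with its `𝒪_{Y,q z}`-module structure through
`q_z♯ : 𝒪_{Y,q z} → 𝒪_{Z,z}` is a FLAT `𝒪_{Y,q z}`-module. [cite: EGAIII2, §6.7] [cite: StacksProject, Tag 08II] [cite: Matsumura1987, §7 (p. 46)] -/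
theorem flat_stalk_pullback_of_isPullback (H : IsPullback p q iX iY) (G : X.Modules) (z : Z) :
    letI : Module (Y.presheaf.stalk (q z)) ((stalkFunctor z).obj ((Scheme.Modules.pullback p).obj G)) :=
      Module.compHom _ ((algebraMap (Z.presheaf.stalk z) (Z.presheaf.stalk z)).comp (q.stalkMap z).hom)
    Module.Flat (Y.presheaf.stalk (q z)) ((stalkFunctor z).obj ((Scheme.Modules.pullback p).obj G)) := by
  -- affine charts `U ∋ p z`, `V ∋ q z`, `W := p⁻¹U ∩ q⁻¹V ∋ z`
  obtain ⟨U, hU, hxU, -⟩ := (Opens.isBasis_iff_nbhd.mp X.isBasis_affineOpens) (show p z ∈ (⊤ : X.Opens) from trivial)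
  obtain ⟨V, hV, hyV, -⟩ := (Opens.isBasis_iff_nbhd.mp Y.isBasis_affineOpens) (show q z ∈ (⊤ : Y.Opens) from trivial)
  have hU' : IsAffineOpen U := hU
  have hV' : IsAffineOpen V := hV
  set W : Z.Opens := p ⁻¹ᵁ U ⊓ q ⁻¹ᵁ V with hWdef
  have hzW : z ∈ W := ⟨hxU, hyV⟩
  have hS : IsAffineOpen (⊤ : (Spec (CommRingCat.of k)).Opens) := isAffineOpen_top _
  have hVS : V ≤ iY ⁻¹ᵁ ⊤ := le_top
  have hUS : U ≤ iX ⁻¹ᵁ ⊤ := le_top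
  have hW : IsAffineOpen W := isAffineOpen_of_isPullback_of_eq_inf H hS hV' hU' hVS hUS hWdef
  have hWU : W ≤ p ⁻¹ᵁ U := inf_le_left
  have hWV : W ≤ q ⁻¹ᵁ V := inf_le_right
  -- the rings of sections and the stalks
  let K₀ : Type u := Γ(Spec (CommRingCat.of k), (⊤ : (Spec (CommRingCat.of k)).Opens))
  let A₀ : Type u := Γ(X, U)
  let B₀ : Type u := Γ(Y, V)
  let C₀ : Type u := Γ(Z, W)
  let Ox : Type u := X.presheaf.stalk (p z)
  let Oy : Type u := Y.presheaf.stalk (q z)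
  let Oz : Type u := Z.presheaf.stalk z
  letI : Field K₀ := (isField_sections_spec_top k).toField
  -- algebra structures: the square of section rings …
  letI algKA : Algebra K₀ A₀ := (iX.appLE ⊤ U hUS).hom.toAlgebra
  letI algKB : Algebra K₀ B₀ := (iY.appLE ⊤ V hVS).hom.toAlgebra
  letI algAC : Algebra A₀ C₀ := (p.appLE U W hWU).hom.toAlgebra
  letI algBC : Algebra B₀ C₀ := (q.appLE V W hWV).hom.toAlgebra
  letI algKC : Algebra K₀ C₀ := ((p.appLE U W hWU).hom.comp (iX.appLE ⊤ U hUS).hom).toAlgebra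
  haveI : IsScalarTower K₀ A₀ C₀ := IsScalarTower.of_algebraMap_eq fun r => rfl
  haveI : IsScalarTower K₀ B₀ C₀ := IsScalarTower.of_algebraMap_eq fun r => by
    change ((p.appLE U W hWU).hom.comp (iX.appLE ⊤ U hUS).hom) r = (q.appLE V W hWV).hom ((iY.appLE ⊤ V hVS).hom r)
    exact appLE_appLE_eq_of_comm_sq H.w hVS hUS hWdef r
  haveI hpush : Algebra.IsPushout K₀ B₀ A₀ C₀ :=
    isPushout_sections_of_isPullback H hS hV' hU' hVS hUS hWdef rfl rfl rfl rfl
  -- … the stalks over the section rings (localizations) …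
  letI algAOx : Algebra A₀ Ox := X.presheaf.algebra_section_stalk (⟨p z, hxU⟩ : U)
  letI algBOy : Algebra B₀ Oy := Y.presheaf.algebra_section_stalk (⟨q z, hyV⟩ : V)
  letI algCOz : Algebra C₀ Oz := Z.presheaf.algebra_section_stalk (⟨z, hzW⟩ : W)
  haveI : IsLocalization.AtPrime Ox (hU'.primeIdealOf ⟨p z, hxU⟩).asIdeal := hU'.isLocalization_stalk ⟨p z, hxU⟩
  haveI : IsLocalization.AtPrime Oy (hV'.primeIdealOf ⟨q z, hyV⟩).asIdeal := hV'.isLocalization_stalk ⟨q z, hyV⟩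
  haveI : IsLocalization.AtPrime Oz (hW.primeIdealOf ⟨z, hzW⟩).asIdeal := hW.isLocalization_stalk ⟨z, hzW⟩
  haveI : Module.Flat C₀ Oz := IsLocalization.flat Oz (hW.primeIdealOf ⟨z, hzW⟩).asIdeal.primeCompl
  -- … and `𝒪_{Z,z}` over `𝒪_{X,p z}`, `𝒪_{Y,q z}` (the stalk maps, spelled as in `ModuleCat.extendScalars`)
  letI algOxOz : Algebra Ox Oz := ((algebraMap Oz Oz).comp (p.stalkMap z).hom).toAlgebra
  letI algOyOz : Algebra Oy Oz := ((algebraMap Oz Oz).comp (q.stalkMap z).hom).toAlgebra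
  letI algAOz : Algebra A₀ Oz := ((algebraMap C₀ Oz).comp (algebraMap A₀ C₀)).toAlgebra
  letI algBOz : Algebra B₀ Oz := ((algebraMap C₀ Oz).comp (algebraMap B₀ C₀)).toAlgebra
  haveI : IsScalarTower A₀ C₀ Oz := IsScalarTower.of_algebraMap_eq fun r => rfl
  haveI : IsScalarTower B₀ C₀ Oz := IsScalarTower.of_algebraMap_eq fun r => rfl
  have hgermA : ∀ a : A₀, algebraMap Ox Oz (algebraMap A₀ Ox a) = algebraMap A₀ Oz a := by
    intro a
    change (p.stalkMap z) (X.presheaf.germ U (p z) hxU a) = Z.presheaf.germ W z hzW (p.appLE U W hWU a)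
    rw [Scheme.Hom.germ_stalkMap_apply, Scheme.Hom.appLE, CommRingCat.comp_apply, TopCat.Presheaf.germ_res_apply]
  have hgermB : ∀ b : B₀, algebraMap Oy Oz (algebraMap B₀ Oy b) = algebraMap B₀ Oz b := by
    intro b
    change (q.stalkMap z) (Y.presheaf.germ V (q z) hyV b) = Z.presheaf.germ W z hzW (q.appLE V W hWV b)
    rw [Scheme.Hom.germ_stalkMap_apply, Scheme.Hom.appLE, CommRingCat.comp_apply, TopCat.Presheaf.germ_res_apply]
  haveI : IsScalarTower A₀ Ox Oz := IsScalarTower.of_algebraMap_eq fun a => (hgermA a).symm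
  haveI : IsScalarTower B₀ Oy Oz := IsScalarTower.of_algebraMap_eq fun b => (hgermB b).symm
  haveI : SMulCommClass Ox B₀ Oz := ⟨fun a b c => by
    simp only [Algebra.smul_def]; rw [mul_left_comm]⟩
  haveI : SMulCommClass Ox Oy Oz := ⟨fun a b c => by
    simp only [Algebra.smul_def]; rw [mul_left_comm]⟩
  -- the `𝒪_{X,p z}`-module `G_{p z}`, an `A₀`-module through the germ map
  let Gx : Type u := (stalkFunctor (p z)).obj G
  letI : Module A₀ Gx := Module.compHom Gx (algebraMap A₀ Ox)
  haveI : IsScalarTower A₀ Ox Gx := IsScalarTower.of_algebraMap_smul fun _ _ => rfl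
  -- the pure algebra: `𝒪_{Z,z} ⊗_{𝒪_{X,p z}} G_{p z}` is flat over `𝒪_{Y,q z}`
  have hflat : Module.Flat Oy (Oz ⊗[Ox] Gx) :=
    Module.Flat.tensorProduct_of_isPushout_field_localization K₀ A₀ B₀ C₀ Ox Oy Oz
      (hU'.primeIdealOf ⟨p z, hxU⟩).asIdeal.primeCompl (hV'.primeIdealOf ⟨q z, hyV⟩).asIdeal.primeCompl Gx
  -- transport along `(p^*G)_z ≅ 𝒪_{Z,z} ⊗_{𝒪_{X,p z}} G_{p z}` (`stalkPullbackIso`), an `𝒪_{Z,z}`-linear hence `𝒪_{Y,q z}`-linear iso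
  let P : Type u := (stalkFunctor z).obj ((Scheme.Modules.pullback p).obj G)
  letI modP : Module Oy P := Module.compHom P ((algebraMap Oz Oz).comp (q.stalkMap z).hom)
  haveI : IsScalarTower Oy Oz P := IsScalarTower.of_algebraMap_smul fun _ _ => rfl
  let e : P ≃ₗ[Oz] Oz ⊗[Ox] Gx := ((stalkPullbackIso p z).app G).toLinearEquiv
  exact Module.Flat.of_linearEquiv (e.restrictScalars Oy)

end Literature.AlgebraicGeometry.Modules

end
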